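import Summits.HubbardSuperconductivity.Statement
import Literature.StrongHypotheses.HubbardSuperconductivity
import HarnessLib
import HarnessLib.Audit.TribunalTags

/-!
# Summit `HubbardSuperconductivity` — bridges of the Strong-Hypothesis Library (D-0034, skeleton)

Summit-side BRIDGE file for the registry `Literature/StrongHypotheses/HubbardSuperconductivity.lean`: for
every `H` tagged there with `@[strong_hypothesis "HubbardSuperconductivity.HubbardSuperconductivity"]`,
exactly ONE bridge tagged `@[summit_bridge "HubbardSuperconductivity.HubbardSuperconductivity"]`, concluding
the ROOT problem decl `_root_.HubbardSuperconductivity`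
(`Summits/HubbardSuperconductivity/HubbardSuperconductivity/Statement.lean`;
`:= Literature.Hubbard.DWaveSuperconductivityHubbard`, unfolded by `HubbardSuperconductivity_iff`), which is
DEFINITIONALLY `∃ U > 0, ∃ δ ∈ Set.Ioo 0 (1/2), HasDWavePairFieldLROAt U δ` over the barrier catalogue's
fixed-parameter matrix (`Literature/Barriers/HubbardSuperconductivity/PureModelStripeCompetition.lean`).

* LANDED bridges (2, both strictly-stronger `H → P`): `hubbardDWaveDome_implies_hubbardSuperconductivity`
  (ABKR 2022 §1 item 1): a dome over a doping interval ⟹ one witness) and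
  `weakCouplingDWaveWindow_implies_hubbardSuperconductivity` (Raghu–Kivelson–Scalapino 2010: `d_{x²-y²}` at
  all small `U` on `0 < δ < 2/5` ⟹ one witness), each the registry's `….exists_witness` lemma followed by
  the definitional unfolding of the summit.
* PRINTED bridges: 0. Summit-side conjecture defs tagged here: 0 (the closed `Prop`s under
  `Summits/HubbardSuperconductivity/HubbardSuperconductivity/{Cruxes,Theorems}` are route criteria / re-cut
  targets — `MesoscopicPairOrder`, `X'_avg`, `X'_th`, `AposterioriOrderCriterionR*` — found by the tribunal's own
  scan; `Theses` decls are never tagged).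

No new mathematics; no `sorry`, no axiom.
-/

noncomputable section

namespace Summit.HubbardSuperconductivity.StrongHypotheses

open Literature.StrongHypotheses.HubbardSuperconductivity

/-! ## Strictly stronger hypotheses (landed bridges) -/

/-- **Dome ⟹ summit** (landed): a `d`-wave dome over a doping interval at some `U > 0`
(`HubbardDWaveDome`, ABKR 2022 §1 item 1)) gives the summit's single witness `(U, (δ₁+δ₂)/2)`
(`HubbardDWaveDome.exists_witness`); the summit is definitionally `∃ U > 0, ∃ δ ∈ Ioo 0 (1/2),
HasDWavePairFieldLROAt U δ`. [cite: ArovasBergKivelsonRaghu2022, §1 item 1)] -/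
@[summit_bridge "HubbardSuperconductivity.HubbardSuperconductivity"]
theorem hubbardDWaveDome_implies_hubbardSuperconductivity :
    HubbardDWaveDome → _root_.HubbardSuperconductivity :=
  fun h => h.exists_witness

/-- **Weak-coupling window ⟹ summit** (landed): `d_{x²-y²}` pair-field LRO at every sufficiently weak
repulsion on the doping interval `(0, 2/5)` (`WeakCouplingDWaveWindow`, Raghu–Kivelson–Scalapino 2010
§III.B) gives the witness `(U₀(1/5)/2, 1/5)` (`WeakCouplingDWaveWindow.exists_witness`).
[cite: RaghuKivelsonScalapino2010, §III.B p. 6] -/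
@[summit_bridge "HubbardSuperconductivity.HubbardSuperconductivity"]
theorem weakCouplingDWaveWindow_implies_hubbardSuperconductivity :
    WeakCouplingDWaveWindow → _root_.HubbardSuperconductivity :=
  fun h => h.exists_witness

end Summit.HubbardSuperconductivity.StrongHypotheses
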